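import Summits.ResolutionOfSingularities.ResolutionOfSingularities.Theorems.WeightedInvariantLocalWeightedDropNCGameToricEndPrep

/-!
# `LocalWeightedDrop`, line `nc-game-transport`, TOT rung R6 (Newton non-degenerate germs): `ToricEnd`, PART 2/2 — at a CHAIN toric
# state the position has normal-crossing support (the Newton-face lemma, inside the game)

[OURS · L1 W4.3 · chain w43, engine crux `LocalWeightedDrop` stmt-ResolutionOfSingularities-8899; strategist res-L1-w43-strat-1's line
`nc-game-transport`, rung R6 `NCTransport.TOTRungNonDegenerate` (`…NCToricRung`, landed verbatim by res-D-pv-006, p518559; `TOT-RUNGS-SPEC.md`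
v3 §R6 (c), `R6-PROVER-NOTES.md` §2); piece (c) → res-type-088 (NAMING 09:20:38Z).]  Nothing here is a statement of any manuscript.
See part 1 (`…NCGameToricEndPrep`) for the notation `E, W, xs, U, ubar, face, gbar, V, L`.

**`toricEnd (m) : NCTransport.ToricEnd m`.**  (E1) the chain cloud has a least vector `e₀ = E(a₀)` and `E(β) ≥ e₀` on `supp b` (`Covers`);
(E2) `b∘x = X^{e₀}·q` with `q(0) = g(ū) = Σ_F b_β ū^β` over the FACE `F = {β ∈ supp b : E(β) = e₀} = supp in_W b` (`W = Σₜ cols t`), and at a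
log slot `z ∉ T`, `∂_z q(0) = Σᵢ L_{z i} Vᵢ`, `Vᵢ = Σ_F βᵢ b_β ū^β`; (E3) toric rows `Σᵢ cols t i Vᵢ = e₀(t) g(ū)`; (E4) `TorusSmooth (in_W b)` through
`Xᵢ ↦ ūᵢ t^{Wᵢ}` forbids `g(ū) = 0 ∧ V = 0`; (E5) log-Jacobian invertible ⇒ `g(ū) ≠ 0` or a log slot with `∂_z q(0) ≠ 0`; (E6) `X^d h = X^{e₀} q` ⇒
`d ≤ e₀`, `B = v·X^{c+e₀−d}·q` ⇒ `germIsNC_of_unitMonomial` / `germIsNC_of_smooth_mul_unitMonomial` (R0, p510594).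
-/

set_option linter.dupNamespace false -- mandated namespace of this single-conjunct summit

namespace Summit.ResolutionOfSingularities.ResolutionOfSingularities.Theorems

namespace NCTransport

namespace ToricEndProof

open MvPowerSeries Literature.AlgebraicGeometry.Resolution TameFourTupleDrop

variable {k : Type} [Field k] {m : ℕ} {b B : MvPowerSeries (Fin (m + 1)) k}

/-! ## The main argument -/

/-- **`ToricEnd`**: at a chain state of a covering cloud, Newton non-degeneracy of the original germ makes the position a normal crossing. -/
theorem toricEnd_aux (st : ToricState b B) (S₀ : Finset (Fin (m + 1) →₀ ℕ)) (hcov : Covers b S₀) (hS₀ : S₀.Nonempty)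
    (hchain : MonomialCloud.incPairs (st.cloud S₀) = ∅) (hND : NewtonNonDegenerate b) : GermIsNC B := by
  classical
  -- (E1) the least cloud vector
  obtain ⟨a₁, ha₁⟩ := hS₀
  obtain ⟨a₀, hleast⟩ := MonomialCloud.exists_least_of_incPairs_eq_empty hchain ⟨a₁, ha₁⟩
  set e₀ : Fin (m + 1) → ℕ := E st a₀ with he₀def
  set e₀f : Fin (m + 1) →₀ ℕ := Finsupp.equivFunOnFinite.symm e₀ with he₀f
  have he₀f_apply : ∀ t, e₀f t = e₀ t := fun t => by simp [he₀f]
  have ha₀b : coeff (a₀ : Fin (m + 1) →₀ ℕ) b ≠ 0 := hcov.1 _ a₀.2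
  have hge : ∀ β, coeff β b ≠ 0 → ∀ t, e₀ t ≤ E st β t := by
    intro β hβ t
    obtain ⟨a, haS, hab⟩ := hcov.2 β hβ
    exact (hleast ⟨a, haS⟩ t).trans (E_mono st hab t)
  have he₀T : ∀ t, t ∉ st.T → e₀ t = 0 := fun t ht => E_eq_zero_of_not_mem st _ ht
  -- the face = the `W`-initial support; membership criteria
  have hface_le : ∀ β, coeff β b ≠ 0 → (Finsupp.equivFunOnFinite.symm (E st β) ≤ e₀f ↔ β ∈ face st e₀) := by
    intro β hβ
    rw [mem_face]
    constructor
    · intro h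
      exact ⟨E_eq_of_le (hge β hβ) (fun t => by have := h t; simpa [he₀f] using this), hβ⟩
    · rintro ⟨h, -⟩
      intro t
      simp [he₀f, h]
  -- (E2) `b∘x = X^{e₀} · q`
  have hvanish : ∀ n : Fin (m + 1) →₀ ℕ, ¬ e₀f ≤ n → coeff n (subst (xs st) b) = 0 := by
    intro n hn
    rw [coeff_subst_xs]
    rw [show (fun β : Fin (m + 1) →₀ ℕ => coeff β b * (if Finsupp.equivFunOnFinite.symm (E st β) ≤ n then
        coeff (n - Finsupp.equivFunOnFinite.symm (E st β)) (U st β) else 0)) = fun _ => 0 from ?_, finsum_zero]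
    funext β
    by_cases hβ : coeff β b = 0
    · rw [hβ, zero_mul]
    · rw [if_neg, mul_zero]
      intro hle
      apply hn
      intro t
      have h1 := hle t
      have h2 := hge β hβ t
      simp only [Finsupp.coe_equivFunOnFinite_symm] at h1
      rw [he₀f_apply]
      omega
  set q : MvPowerSeries (Fin (m + 1)) k := fun n => coeff (n + e₀f) (subst (xs st) b) with hqdef
  have hcoeff_q : ∀ n, coeff n q = coeff (n + e₀f) (subst (xs st) b) := fun n => rfl
  have hfac : subst (xs st) b = monomial e₀f 1 * q := by
    ext n
    rw [coeff_monomial_mul]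
    split_ifs with h
    · rw [one_mul, hcoeff_q, tsub_add_cancel_of_le h]
    · exact hvanish n h
  -- `q(0) = g(ū)`
  have hq0 : constantCoeff q = gbar st e₀ := by
    rw [← coeff_zero_eq_constantCoeff_apply, hcoeff_q, zero_add, coeff_subst_xs]
    rw [finsum_eq_sum_of_support_subset (s := face st e₀)]
    · refine Finset.sum_congr rfl fun β hβ => ?_
      obtain ⟨hE, hβ0⟩ := mem_face.mp hβ
      rw [if_pos ((hface_le β hβ0).mpr hβ), show e₀f - Finsupp.equivFunOnFinite.symm (E st β) = 0 from ?_,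
        coeff_zero_eq_constantCoeff_apply]
      · unfold U ubar; rw [map_prod]; simp_rw [map_pow]
      · ext t; simp [he₀f, hE]
    · intro β hβ
      rw [Function.mem_support] at hβ
      rw [Finset.mem_coe]
      by_cases hβ0 : coeff β b = 0
      · exact absurd (by rw [hβ0, zero_mul]) hβ
      · by_contra hnot
        exact hβ (by rw [if_neg (fun h => hnot ((hface_le β hβ0).mp h)), mul_zero])
  -- the linear coefficient of `q` at a log slot
  have hqz : ∀ z, z ∉ st.T → coeff (Finsupp.single z 1) q = ∑ i, L st z i * V st e₀ i := by
    intro z hz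
    rw [hcoeff_q, coeff_subst_xs, finsum_eq_sum_of_support_subset (s := face st e₀)]
    · -- only the face contributes, through the logarithmic Leibniz rule
      have hterm : ∀ β ∈ face st e₀, coeff β b * (if Finsupp.equivFunOnFinite.symm (E st β) ≤ Finsupp.single z 1 + e₀f then
          coeff (Finsupp.single z 1 + e₀f - Finsupp.equivFunOnFinite.symm (E st β)) (U st β) else 0) =
          coeff β b * ((∏ i, ubar st i ^ β i) * ∑ i, (β i : k) * coeff (Finsupp.single z 1) (st.u i) * (constantCoeff (st.u i))⁻¹) := by
        intro β hβ
        obtain ⟨hE, hβ0⟩ := mem_face.mp hβ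
        have hEq : Finsupp.equivFunOnFinite.symm (E st β) = e₀f := by ext t; simp [he₀f, hE]
        rw [hEq, if_pos (le_add_self), add_tsub_cancel_right]
        unfold U ubar
        rw [coeff_single_one_prod_pow _ _ _ (fun i _ => st.u_unit i)]
      rw [Finset.sum_congr rfl hterm]
      unfold V L
      simp only [Matrix.of_apply, if_neg hz, Finset.mul_sum]
      rw [Finset.sum_comm]
      exact Finset.sum_congr rfl fun i _ => Finset.sum_congr rfl fun β _ => by ring
    · intro β hβ
      rw [Function.mem_support] at hβ
      rw [Finset.mem_coe]
      by_cases hβ0 : coeff β b = 0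
      · exact absurd (by rw [hβ0, zero_mul]) hβ
      · by_contra hnot
        apply hβ
        rw [if_neg, mul_zero]
        intro hle
        apply hnot
        rw [← hface_le β hβ0]
        intro t
        have h1 := hle t
        by_cases htz : t = z
        · subst htz
          have : E st β t = 0 := E_eq_zero_of_not_mem st β hz
          simp only [Finsupp.coe_equivFunOnFinite_symm, this]
          exact Nat.zero_le _
        · simp only [Finsupp.coe_add, Pi.add_apply, Finsupp.single_apply, if_neg (Ne.symm htz), zero_add] at h1
          exact h1
  -- (E3) the toric rows
  have htoric : ∀ t, t ∈ st.T → ∑ i, L st t i * V st e₀ i = (e₀ t : k) * gbar st e₀ := by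
    intro t ht
    unfold L V gbar
    simp only [Matrix.of_apply, if_pos ht, Finset.mul_sum]
    rw [Finset.sum_comm]
    refine Finset.sum_congr rfl fun β hβ => ?_
    obtain ⟨hE, -⟩ := mem_face.mp hβ
    have hEt : ((E st β t : ℕ) : k) = e₀ t := by rw [hE]
    rw [← hEt]
    unfold E
    rw [Nat.cast_sum, Finset.sum_mul]
    exact Finset.sum_congr rfl fun i _ => by push_cast; ring
  -- (E4) Newton non-degeneracy of the `W`-initial form, read through `Xᵢ ↦ ūᵢ · t^{Wᵢ}`
  have hW : ∀ i, 0 < W st i := fun i => Nat.pos_of_ne_zero (W_ne_zero st i)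
  have hD : Finsupp.weight (W st) (a₀ : Fin (m + 1) →₀ ℕ) = ∑ t, e₀ t := weight_eq_sum_E st _
  have hweight_ge : ∀ β, coeff β b ≠ 0 → ∑ t, e₀ t ≤ Finsupp.weight (W st) β := by
    intro β hβ
    rw [weight_eq_sum_E]
    exact Finset.sum_le_sum fun t _ => hge β hβ t
  have hweight_eq : ∀ β, coeff β b ≠ 0 → (Finsupp.weight (W st) β = ∑ t, e₀ t ↔ E st β = e₀) := by
    intro β hβ
    rw [weight_eq_sum_E]
    constructor
    · intro h
      exact funext fun t => ((Finset.sum_eq_sum_iff_of_le fun t _ => hge β hβ t).mp h.symm t (Finset.mem_univ t)).symm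
    · intro h; rw [h]
  have horder : b.weightedOrder (W st) = ((∑ t, e₀ t : ℕ) : ℕ∞) := by
    rw [weightedOrder_eq_nat]
    refine ⟨⟨a₀, ha₀b, hD⟩, fun β hlt => ?_⟩
    by_contra hβ
    exact absurd (hweight_ge β hβ) (not_le.mpr hlt)
  have hinit : initForm (W st) b = ∑ β ∈ face st e₀, monomial β (coeff β b) := by
    ext α
    rw [map_sum]
    simp_rw [coeff_monomial]
    rw [Finset.sum_ite_eq]
    show (if ((Finsupp.weight (W st) α : ℕ) : ℕ∞) = b.weightedOrder (W st) then coeff α b else 0) = _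
    simp only [horder, Nat.cast_inj]
    by_cases hα : coeff α b = 0
    · rw [hα, if_neg (fun h => (mem_face.mp h).2 hα)]; split_ifs <;> rfl
    · by_cases hw : Finsupp.weight (W st) α = ∑ t, e₀ t
      · rw [if_pos hw, if_pos (mem_face.mpr ⟨(hweight_eq α hα).mp hw, hα⟩)]
      · rw [if_neg hw, if_neg (fun h => hw ((hweight_eq α hα).mpr (mem_face.mp h).1))]
  have heuler : ∀ i, eulerOp i (initForm (W st) b) = ∑ β ∈ face st e₀, monomial β ((β i : k) * coeff β b) := by
    intro i
    ext α
    show ((α i : ℕ) : k) * coeff α (initForm (W st) b) = _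
    rw [hinit, map_sum, map_sum]
    simp_rw [coeff_monomial]
    rw [Finset.sum_ite_eq, Finset.sum_ite_eq]
    split_ifs <;> simp
  have hgV : ¬ (gbar st e₀ = 0 ∧ ∀ i, V st e₀ i = 0) := by
    rintro ⟨hg, hV⟩
    obtain ⟨N, hN⟩ := hND (W st) hW
    -- the evaluation hom
    set φa : Fin (m + 1) → MvPowerSeries (Fin 1) k := fun i => C (ubar st i) * X 0 ^ W st i with hφa
    have hφ : HasSubst φa := hasSubst_of_constantCoeff_zero fun i => by
      rw [hφa]; simp only [map_mul, map_pow, constantCoeff_C, constantCoeff_X, zero_pow (W_ne_zero st i), mul_zero]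
    have hprodφ : ∀ β : Fin (m + 1) →₀ ℕ, (∏ i, φa i ^ β i) = C (∏ i, ubar st i ^ β i) * X 0 ^ Finsupp.weight (W st) β := by
      intro β
      have h1 : ∀ i, φa i ^ β i = C (ubar st i ^ β i) * X 0 ^ (W st i * β i) := by
        intro i
        simp only [hφa]
        rw [mul_pow, ← map_pow, ← pow_mul]
      have hw : ∑ i, W st i * β i = Finsupp.weight (W st) β := by
        rw [Finsupp.weight_apply, Finsupp.sum_fintype _ _ (fun i => by simp)]
        exact Finset.sum_congr rfl fun i _ => by rw [smul_eq_mul, mul_comm]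
      simp_rw [h1]
      rw [Finset.prod_mul_distrib, ← map_prod, Finset.prod_pow_eq_pow_sum, hw]
    have hmon : ∀ (β : Fin (m + 1) →₀ ℕ) (r : k), subst φa (monomial β r) =
        C (r * ∏ i, ubar st i ^ β i) * X 0 ^ Finsupp.weight (W st) β := by
      intro β r
      rw [subst_monomial hφ, Finsupp.prod_fintype _ _ (fun i => pow_zero _), hprodφ, ← c_eq_algebraMap, map_mul, mul_assoc]
    have hφg : subst φa (initForm (W st) b) = 0 := by
      rw [hinit, ← coe_substAlgHom hφ, map_sum]
      have : ∀ β ∈ face st e₀, substAlgHom hφ (monomial β (coeff β b)) =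
          C (coeff β b * ∏ i, ubar st i ^ β i) * X 0 ^ (∑ t, e₀ t) := by
        intro β hβ
        obtain ⟨hE, hβ0⟩ := mem_face.mp hβ
        rw [coe_substAlgHom, hmon, (hweight_eq β hβ0).mpr hE]
      rw [Finset.sum_congr rfl this, ← Finset.sum_mul, ← map_sum]
      change C (gbar st e₀) * _ = 0
      rw [hg, map_zero, zero_mul]
    have hφe : ∀ i, subst φa (eulerOp i (initForm (W st) b)) = 0 := by
      intro i
      rw [heuler, ← coe_substAlgHom hφ, map_sum]
      have : ∀ β ∈ face st e₀, substAlgHom hφ (monomial β ((β i : k) * coeff β b)) =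
          C ((β i : k) * coeff β b * ∏ j, ubar st j ^ β j) * X 0 ^ (∑ t, e₀ t) := by
        intro β hβ
        obtain ⟨hE, hβ0⟩ := mem_face.mp hβ
        rw [coe_substAlgHom, hmon, (hweight_eq β hβ0).mpr hE]
      rw [Finset.sum_congr rfl this, ← Finset.sum_mul, ← map_sum]
      change C (V st e₀ i) * _ = 0
      rw [hV i, map_zero, zero_mul]
    -- the ideal collapses under the evaluation, yet contains a non-zero image
    have hmap : Ideal.map (substAlgHom hφ)
        (Ideal.span (insert (initForm (W st) b) (Set.range fun i => eulerOp i (initForm (W st) b)))) = ⊥ := by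
      rw [Ideal.map_span, Ideal.span_eq_bot]
      rintro _ ⟨y, hy, rfl⟩
      rcases hy with rfl | ⟨i, rfl⟩
      · rw [coe_substAlgHom]; exact hφg
      · rw [coe_substAlgHom]; exact hφe i
    have hmem := Ideal.mem_map_of_mem (substAlgHom hφ) hN
    rw [hmap, Ideal.mem_bot] at hmem
    -- but the image of `(∏ X)^N` is a non-zero constant times a power of `t`
    have himg : substAlgHom hφ ((∏ i : Fin (m + 1), (X i : MvPowerSeries (Fin (m + 1)) k)) ^ N) =
        C ((∏ i, ubar st i) ^ N) * X 0 ^ ((∑ i, W st i) * N) := by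
      rw [map_pow, map_prod]
      simp_rw [substAlgHom_X]
      have h1 : (∏ i, φa i) = C (∏ i, ubar st i) * X 0 ^ (∑ i, W st i) := by
        simp only [hφa]
        rw [Finset.prod_mul_distrib, ← map_prod, Finset.prod_pow_eq_pow_sum]
      rw [h1, mul_pow, ← map_pow, ← pow_mul]
    rw [himg] at hmem
    have hc : (∏ i, ubar st i) ^ N ≠ 0 := pow_ne_zero _ (Finset.prod_ne_zero_iff.mpr fun i _ => st.u_unit i)
    have hX : (X (0 : Fin 1) : MvPowerSeries (Fin 1) k) ^ ((∑ i, W st i) * N) ≠ 0 :=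
      pow_ne_zero _ (FormalCoordChange.X_ne_zero' _)
    exact (mul_ne_zero (fun h => hc ((map_eq_zero_iff C (C_injective)).mp h)) hX) hmem
  -- (E5) a unit, or a good log slot
  have hgood : gbar st e₀ ≠ 0 ∨ ∃ z, z ∉ st.T ∧ coeff (Finsupp.single z 1) q ≠ 0 := by
    by_contra hbad
    push Not at hbad
    obtain ⟨hg, hz⟩ := hbad
    apply hgV
    refine ⟨hg, ?_⟩
    have hLV : (L st).mulVec (V st e₀) = 0 := by
      funext t
      rw [Matrix.mulVec, dotProduct, Pi.zero_apply]
      by_cases ht : t ∈ st.T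
      · rw [htoric t ht, hg, mul_zero]
      · rw [← hqz t ht, hz t ht]
    have hinj := Matrix.mulVec_injective_iff_isUnit.mpr (isUnit_L st)
    have hV0 : V st e₀ = 0 := hinj (by rw [hLV, Matrix.mulVec_zero])
    exact fun i => congr_fun hV0 i
  -- (E6) comparison with the state's `X^d · h` and conclusion
  set df : Fin (m + 1) →₀ ℕ := Finsupp.equivFunOnFinite.symm st.d with hdf
  have htot : monomial df 1 * st.h = monomial e₀f 1 * q := by
    rw [← hfac, ← MonomialWon.prod_X_pow_eq_monomial]
    exact st.total_eq.symm
  have hdle : df ≤ e₀f := by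
    intro t
    rcases hgood with hg | ⟨z, hz, hqz0⟩
    · -- compare the coefficients at `e₀`
      have h1 : coeff e₀f (monomial df 1 * st.h) = coeff e₀f (monomial e₀f 1 * q) := by rw [htot]
      rw [coeff_monomial_mul, coeff_monomial_mul, if_pos le_rfl, tsub_self, coeff_zero_eq_constantCoeff_apply, hq0] at h1
      by_contra hlt
      rw [if_neg (fun h => hlt (h t)), one_mul] at h1
      exact hg h1.symm
    · -- compare the coefficients at `e₀ + δ_z`
      have h1 : coeff (Finsupp.single z 1 + e₀f) (monomial df 1 * st.h) = coeff (Finsupp.single z 1 + e₀f) (monomial e₀f 1 * q) := by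
        rw [htot]
      rw [coeff_monomial_mul, coeff_monomial_mul, if_pos le_add_self, add_tsub_cancel_right] at h1
      by_contra hlt
      rw [if_neg, one_mul] at h1
      · exact hqz0 h1.symm
      · intro hle
        apply hlt
        have h2 := hle t
        by_cases htz : t = z
        · subst htz
          have : st.d t = 0 := st.d_zero t hz
          simp [hdf, this]
        · simp only [Finsupp.coe_add, Pi.add_apply, Finsupp.single_apply, if_neg (Ne.symm htz), zero_add] at h2
          exact h2
  have hh : st.h = monomial (e₀f - df) 1 * q := by
    have hne : (monomial df (1 : k) : MvPowerSeries (Fin (m + 1)) k) ≠ 0 := by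
      rw [← MonomialWon.prod_X_pow_eq_monomial]
      exact Finset.prod_ne_zero_iff.mpr fun t _ => pow_ne_zero _ (FormalCoordChange.X_ne_zero' t)
    refine mul_left_cancel₀ hne ?_
    rw [htot, ← mul_assoc, monomial_mul_monomial, one_mul, add_tsub_cancel_of_le hdle]
  -- the position
  set vexp : Fin (m + 1) → ℕ := fun t => st.c t + (e₀ t - st.d t) with hvexp
  have hvexpf : (Finsupp.equivFunOnFinite.symm vexp : Fin (m + 1) →₀ ℕ) = Finsupp.equivFunOnFinite.symm st.c + (e₀f - df) := by
    ext t; simp [hvexp, he₀f, hdf]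
  have hB : B = (st.v * q) * ∏ t, X t ^ vexp t :=
    calc B = st.v * (∏ t, X t ^ st.c t) * st.h := st.pos_eq
      _ = (st.v * q) * ∏ t, X t ^ vexp t := by
        have hm : (monomial (Finsupp.equivFunOnFinite.symm st.c + (e₀f - df)) (1 : k) : MvPowerSeries (Fin (m + 1)) k) =
            monomial (Finsupp.equivFunOnFinite.symm st.c) 1 * monomial (e₀f - df) 1 := by
          rw [monomial_mul_monomial, one_mul]
        rw [hh, MonomialWon.prod_X_pow_eq_monomial, MonomialWon.prod_X_pow_eq_monomial, hvexpf, hm]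
        ring
  rcases hgood with hg | ⟨z, hz, hqz0⟩
  · -- a unit monomial
    refine TupleMonomialPhase.germIsNC_of_unitMonomial ⟨st.v * q, vexp, ?_, hB⟩
    rw [map_mul, hq0]
    exact mul_ne_zero st.v_unit hg
  · -- a smooth germ with a log-variable linear term, times a unit monomial in the other variables
    by_cases hg : gbar st e₀ ≠ 0
    · refine TupleMonomialPhase.germIsNC_of_unitMonomial ⟨st.v * q, vexp, ?_, hB⟩
      rw [map_mul, hq0]
      exact mul_ne_zero st.v_unit hg
    · rw [not_not] at hg
      have hvz : vexp z = 0 := by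
        simp only [hvexp, st.c_zero z hz, st.d_zero z hz, he₀T z hz]
      have hB' : B = st.v * q ^ 1 * ∏ t, X t ^ vexp t := by rw [pow_one]; exact hB
      rw [hB']
      exact germIsNC_of_smooth_mul_unitMonomial z (by rw [hq0, hg]) hqz0 st.v_unit 1 hvz

end ToricEndProof

/-- **R6 (c): `ToricEnd m` HOLDS** (OURS · L1 W4.3, line `nc-game-transport`): at a chain toric state of a covering cloud, Newton non-degeneracy
of the original germ makes the position a normal crossing. -/
theorem toricEnd (m : ℕ) : ToricEnd m :=
  fun _ _ _ _ st S₀ hcov hS₀ hchain hND => ToricEndProof.toricEnd_aux st S₀ hcov hS₀ hchain hND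

end NCTransport

end Summit.ResolutionOfSingularities.ResolutionOfSingularities.Theorems
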